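import Summits.ABC.IUTFork.Cor312Statement
import Summits.ABC.IUTFork.Thm311Real
import Summits.ABC.IUTFork.Cor312ProvenanceDH
import Mathlib.Analysis.Real.Pi.Bounds
import Mathlib.Analysis.Complex.ExponentialBounds
import HarnessLib

/-!
# [IUTchIII] Corollary 3.12 at the FOURTH CORNER (print-normalised weights, honest archimedean place): the SIGN of
# the one real number that decides TEAM B's region-volume input there, in closed form in `(l, log(q))`

PROOF-ONLY record file (D-0012; no definitions) of the abc-iut cell (wave-5 prover seat abc-iut-w5-d235, gen 6);
TAKES NO SIDE. At the honest-`∞` corner of the assembled real setting (abc-iut-w5-d163 `settingPrVolArch`, abc-iut-c312-7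
`settingPrVolArchSharp`) the procession-normalised global volume of every family of Kummer images of the Θ-pilot object is
`−deĝ̲_lgp(P_Θ) + 𝔼_{j ∈ 𝔽_l^⋇} |S^±_{j+1}|·log π` (abc-iut-c312-7, `processionNormalized_thetaRegion_settingPrVolArchSharp`,
staged), the `q`-pilot volume is `−deĝ̲(P_q)` (no archimedean correction), and TEAM B's input `GlobalVolumeTransport` is
therefore EQUIVALENT to the real inequality

  `(⋆)  −deĝ̲(P_q) ≤ −deĝ̲_lgp(P_Θ) + 𝔼_{j ∈ 𝔽_l^⋇} |S^±_{j+1}|·log π`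

(their `globalVolumeTransport_settingPrVolArchSharp_iff`), whose sign was left unevaluated. THIS file evaluates it over
LANDED vocabulary only (Dupuy–Hilado pilot divisors `Literature.IUT.LogVolume.PilotData`, the index skeleton
`Thm311.Real.thetaIndex`, `Cor312.Setting.labelSucc`, `Literature.IUT.LogThetaLattice.processionNormalized`), so that it
composes with the fourth-corner files by `Iff.trans` once they land:

* `card_caps_labelSucc`, `processionNormalized_card_caps_mul` — `|S^±_{j+1}| = j+1` and `𝔼_{j=1..ℓ⋇}(j+1) = (ℓ⋇+3)/2`;
* **`archCornerIneq_iff_lstar`** — `(⋆) ⟺ ((ℓ⋇+1)(2ℓ⋇+1)/6 − 1)·deĝ̲(P_q) ≤ ((ℓ⋇+3)/2)·log π`;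
* **`archCornerIneq_iff_qDivisor`** — `(⋆) ⟺ (l+4)(l−3)·deĝ̲(𝔮) ≤ 6l(l+5)·log π` with `𝔮 = Σ_{v∈S} ord_v(q_v)[v]` the divisor of
  the Tate parameters (`deĝ̲(𝔮)` is [IUTchIV]'s `log(q)`), i.e. `log(q) ≤ c(l)·log π`, `c(l) = 6l(l+5)/((l+4)(l−3))`
  (`c(5) = 50/3`, `c(7) = 126/11`, `c(l) ↓ 6`);
* **`archCornerIneq_of_ndeg_qDivisor_le_six`** / **`not_archCornerIneq_of_twenty_le_ndeg_qDivisor`** — uniformly in the prime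
  `l ≥ 5`: `(⋆)` HOLDS whenever `log(q) ≤ 6` (from `1 < log π`) and FAILS whenever `log(q) ≥ 20` (from `log π < 1.15`);
* **`archCornerIneq_iff_logq`** — at GENUINE initial Θ-data (`Cor312Prov.IsPilotDataOf D X`, abc-iut-c312-8) `(⋆)` reads
  `(l+4)(l−3)·log(q) ≤ 6l(l+5)·log π` with `log(q) = Cor312Prov.logq D` of [IUTchIV] Thm. 1.10, and the two uniform
  corollaries in `logq D`.

So at the honest-`∞` corner TEAM B's region-volume input (GAP row G-c312-11-1) is neither a theorem nor refuted outright: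
it is TRUE exactly for Θ-data whose `log(q)` lies below an explicit constant of size `O(log π)` and FALSE above it
(contrast: FALSE for every datum at the trivial-`∞` corner, abc-iut-c312-7 `not_globalVolumeTransport_settingPrVolSharp`).
Nothing here evaluates `−|log(Θ)|` (the hull side) or asserts/denies the printed inequality of Cor. 3.12.
[claim: Mochizuki2012, status: disputed] for the quoted setting; [cite: DupuyHilado2025, Def. 3.1.1, §3.3];
[cite: Mochizuki2012, IUTchIV Thm 1.10 proof Step (vii) p. 30]. HONEST FRAMING: numbers at one model corner; no judgement.
typed ≠ proved; instantiated ≠ endorsed.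
-/

noncomputable section

namespace Summit.ABC.IUTFork.Thm311.Real

open NumberField IsDedekindDomain Literature.IUT.LogVolume Literature.IUT.LogThetaLattice Finset

variable {F : Type} [Field F] [NumberField F] (X : PilotData F)

/-! ## 1. The archimedean constant `𝔼_{j ∈ 𝔽_l^⋇} |S^±_{j+1}|·log π = ((ℓ⋇+3)/2)·log π` -/

/-- `|S^±_{j+1}| = j + 1 = i + 2` at the label `j = i+1 ∈ 𝔽_l^⋇` ([IUTchI] Prop. 6.9 (i) "`S^±_t = {0, 1, …, t−1}`").
[claim: Mochizuki2012, status: disputed] -/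
theorem card_caps_labelSucc (i : Fin (thetaIndex X).lstar) :
    Fintype.card ((thetaIndex X).Caps (Cor312.Setting.labelSucc i)) = (i : ℕ) + 2 := by
  show Fintype.card (Fin (((Fin.succ i : Fin (X.lstar + 1)) : ℕ) + 1)) = _
  rw [Fintype.card_fin, Fin.val_succ]

/-- Plumbing: `Σ_{i<n} (i+2) = n(n+3)/2` over `ℝ`. [folklore] -/
private theorem sum_add_two (n : ℕ) : ∑ i ∈ range n, (((i : ℕ) : ℝ) + 2) = (n : ℝ) * (n + 3) / 2 := by
  induction n with
  | zero => simp
  | succ n ih =>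
    rw [Finset.sum_range_succ, ih]
    push_cast
    ring

/-- **`𝔼_{j ∈ 𝔽_l^⋇} |S^±_{j+1}|·c = ((ℓ⋇+3)/2)·c`**: the procession-normalised average of the capsule cardinalities
`j+1`, `j = 1, …, ℓ⋇`, is `(ℓ⋇+3)/2` ([IUTchIII] Prop. 3.9 (i): the average over the capsules of the procession).
[claim: Mochizuki2012, status: disputed] -/
theorem processionNormalized_card_caps_mul (c : ℝ) :
    processionNormalized (fun i : Fin (thetaIndex X).lstar =>
        (Fintype.card ((thetaIndex X).Caps (Cor312.Setting.labelSucc i)) : ℝ) * c) =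
      (((X.lstar : ℝ) + 3) / 2) * c := by
  have hn : (X.lstar : ℝ) ≠ 0 := by
    have := X.two_le_lstar; exact_mod_cast (by omega : X.lstar ≠ 0)
  simp only [processionNormalized, card_caps_labelSucc, ← Finset.sum_mul]
  push_cast
  rw [Fin.sum_univ_eq_sum_range (fun i => ((i : ℝ) + 2)) (thetaIndex X).lstar]
  change (∑ i ∈ range X.lstar, ((i : ℝ) + 2)) * c / (X.lstar : ℝ) = _
  rw [sum_add_two]
  field_simp

/-! ## 2. The sign of `(⋆)` in closed form -/

/-- `deĝ̲_lgp(P_Θ) = ((ℓ⋇+1)(2ℓ⋇+1)/6)·deĝ̲(P_q)` (abc-iut-c312-3's `PilotData.degLgp_thetaPilot`, divided by `[F:ℚ]`).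
[cite: DupuyHilado2025, Def. 3.1.1, §3.3] -/
private theorem ndegLgp_thetaPilot_eq_avgWeight_mul :
    LgpDivisor.ndegLgp X.thetaPilot =
      (((X.lstar : ℝ) + 1) * (2 * X.lstar + 1) / 6) * FinDivisor.ndeg F X.qPilot := by
  rw [LgpDivisor.ndegLgp_eq, PilotData.degLgp_thetaPilot, FinDivisor.ndeg_apply]
  ring

/-- `deĝ̲(P_q) = deĝ̲(𝔮)/(2l)` (abc-iut-c312-3's `PilotData.deg_qPilot`, divided by `[F:ℚ]`). [cite: DupuyHilado2025, §3.3] -/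
private theorem ndeg_qPilot_eq_ndeg_qDivisor_div :
    FinDivisor.ndeg F X.qPilot = FinDivisor.ndeg F X.qDivisor / (2 * X.l) := by
  rw [FinDivisor.ndeg_apply, FinDivisor.ndeg_apply, PilotData.deg_qPilot]
  ring

/-- **The sign of `(⋆)`, first form**: `−deĝ̲(P_q) ≤ −deĝ̲_lgp(P_Θ) + 𝔼_j |S^±_{j+1}|·log π` if and only if
`((ℓ⋇+1)(2ℓ⋇+1)/6 − 1)·deĝ̲(P_q) ≤ ((ℓ⋇+3)/2)·log π` — the Θ-side's EXCESS average weight times the `q`-pilot degree against the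
archimedean constant. [cite: DupuyHilado2025, Def. 3.1.1, §3.3] [claim: Mochizuki2012, status: disputed] -/
theorem archCornerIneq_iff_lstar :
    -FinDivisor.ndeg F X.qPilot ≤ -LgpDivisor.ndegLgp X.thetaPilot +
        processionNormalized (fun i : Fin (thetaIndex X).lstar =>
          (Fintype.card ((thetaIndex X).Caps (Cor312.Setting.labelSucc i)) : ℝ) * Real.log Real.pi) ↔
      (((X.lstar : ℝ) + 1) * (2 * X.lstar + 1) / 6 - 1) * FinDivisor.ndeg F X.qPilot ≤
        (((X.lstar : ℝ) + 3) / 2) * Real.log Real.pi := by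
  rw [processionNormalized_card_caps_mul, ndegLgp_thetaPilot_eq_avgWeight_mul]
  constructor <;> intro h <;> linarith

/-- **The sign of `(⋆)` in closed form**: `(⋆) ⟺ (l+4)(l−3)·deĝ̲(𝔮) ≤ 6l(l+5)·log π`, where `deĝ̲(𝔮) = Σ_{v∈S} ord_v(q_v)·log|κ(v)|/[F:ℚ]`
is [IUTchIV]'s `log(q)`; equivalently `log(q) ≤ c(l)·log π` with `c(l) = 6l(l+5)/((l+4)(l−3))` (`l ≥ 5` prime, so `(l+4)(l−3) > 0`).
[cite: DupuyHilado2025, §3.3] [claim: Mochizuki2012, status: disputed] -/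
theorem archCornerIneq_iff_qDivisor :
    -FinDivisor.ndeg F X.qPilot ≤ -LgpDivisor.ndegLgp X.thetaPilot +
        processionNormalized (fun i : Fin (thetaIndex X).lstar =>
          (Fintype.card ((thetaIndex X).Caps (Cor312.Setting.labelSucc i)) : ℝ) * Real.log Real.pi) ↔
      ((X.l : ℝ) + 4) * (X.l - 3) * FinDivisor.ndeg F X.qDivisor ≤ 6 * X.l * (X.l + 5) * Real.log Real.pi := by
  rw [archCornerIneq_iff_lstar, ndeg_qPilot_eq_ndeg_qDivisor_div, X.l_cast]
  have h2 : (2 : ℝ) ≤ X.lstar := by exact_mod_cast X.two_le_lstar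
  have hl : (0 : ℝ) < 2 * (2 * X.lstar + 1) := by positivity
  -- clear the denominator `2l = 2(2ℓ⋇+1)` and compare the two polynomial forms
  rw [show (((X.lstar : ℝ) + 1) * (2 * X.lstar + 1) / 6 - 1) * (FinDivisor.ndeg F X.qDivisor / (2 * (2 * X.lstar + 1))) =
      ((2 * X.lstar + 5) * (X.lstar - 1) / 6) * FinDivisor.ndeg F X.qDivisor / (2 * (2 * X.lstar + 1)) by ring,
    div_le_iff₀ hl]
  constructor <;> intro h <;> nlinarith

/-! ## 3. Uniform corollaries in the prime `l ≥ 5` -/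

/-- `1 < log π` (`e < 3 < π`). [folklore] -/
private theorem one_lt_log_pi : 1 < Real.log Real.pi := by
  rw [Real.lt_log_iff_exp_lt Real.pi_pos]
  have h1 := Real.exp_one_lt_d9
  have h3 := Real.pi_gt_three
  linarith

/-- `log π < 1.15` (`π < 3.15 < e·(1 + 0.15 + 0.15²/2) ≤ e^{1.15}`). [folklore] -/
private theorem log_pi_lt : Real.log Real.pi < 1.15 := by
  rw [Real.log_lt_iff_lt_exp Real.pi_pos]
  have hπ := Real.pi_lt_d2
  have he := Real.exp_one_gt_d9
  have hq : (1 : ℝ) + 0.15 + 0.15 ^ 2 / 2 ≤ Real.exp 0.15 := Real.quadratic_le_exp_of_nonneg (by norm_num)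
  have hsplit : Real.exp (1.15 : ℝ) = Real.exp 1 * Real.exp 0.15 := by
    rw [← Real.exp_add]; norm_num
  rw [hsplit]
  nlinarith [Real.exp_pos (1 : ℝ), Real.exp_pos (0.15 : ℝ)]

/-- **`(⋆)` HOLDS whenever `log(q) = deĝ̲(𝔮) ≤ 6`**, for every prime `l ≥ 5` (since `c(l) > 6` and `log π > 1`): at such Θ-data
TEAM B's region-volume input is TRUE at the honest-`∞` corner. [cite: DupuyHilado2025, §3.3]
[claim: Mochizuki2012, status: disputed] -/
theorem archCornerIneq_of_ndeg_qDivisor_le_six (h : FinDivisor.ndeg F X.qDivisor ≤ 6) :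
    -FinDivisor.ndeg F X.qPilot ≤ -LgpDivisor.ndegLgp X.thetaPilot +
        processionNormalized (fun i : Fin (thetaIndex X).lstar =>
          (Fintype.card ((thetaIndex X).Caps (Cor312.Setting.labelSucc i)) : ℝ) * Real.log Real.pi) := by
  rw [archCornerIneq_iff_qDivisor]
  have h5 : (5 : ℝ) ≤ X.l := by exact_mod_cast X.five_le_l
  have hπ := one_lt_log_pi
  have hpos : (0 : ℝ) < ((X.l : ℝ) + 4) * (X.l - 3) := by nlinarith
  have hl0 : (0 : ℝ) ≤ 6 * X.l * (X.l + 5) := by positivity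
  calc ((X.l : ℝ) + 4) * (X.l - 3) * FinDivisor.ndeg F X.qDivisor
      ≤ ((X.l : ℝ) + 4) * (X.l - 3) * 6 := mul_le_mul_of_nonneg_left h hpos.le
    _ ≤ 6 * X.l * (X.l + 5) * 1 := by nlinarith
    _ ≤ 6 * X.l * (X.l + 5) * Real.log Real.pi := mul_le_mul_of_nonneg_left hπ.le hl0

/-- **`(⋆)` FAILS whenever `log(q) = deĝ̲(𝔮) ≥ 20`**, for every prime `l ≥ 5` (since `c(l) ≤ c(5) = 50/3` and `log π < 1.15`):
at such Θ-data TEAM B's region-volume input is FALSE at the honest-`∞` corner as well. [cite: DupuyHilado2025, §3.3]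
[claim: Mochizuki2012, status: disputed] -/
theorem not_archCornerIneq_of_twenty_le_ndeg_qDivisor (h : 20 ≤ FinDivisor.ndeg F X.qDivisor) :
    ¬ (-FinDivisor.ndeg F X.qPilot ≤ -LgpDivisor.ndegLgp X.thetaPilot +
        processionNormalized (fun i : Fin (thetaIndex X).lstar =>
          (Fintype.card ((thetaIndex X).Caps (Cor312.Setting.labelSucc i)) : ℝ) * Real.log Real.pi)) := by
  rw [archCornerIneq_iff_qDivisor, not_le]
  have h5 : (5 : ℝ) ≤ X.l := by exact_mod_cast X.five_le_l
  have hπ := log_pi_lt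
  have hl0 : (0 : ℝ) < 6 * X.l * (X.l + 5) := by positivity
  have hpos : (0 : ℝ) ≤ ((X.l : ℝ) + 4) * (X.l - 3) := by nlinarith
  calc 6 * (X.l : ℝ) * (X.l + 5) * Real.log Real.pi
      < 6 * X.l * (X.l + 5) * 1.15 := mul_lt_mul_of_pos_left hπ hl0
    _ ≤ ((X.l : ℝ) + 4) * (X.l - 3) * 20 := by nlinarith
    _ ≤ ((X.l : ℝ) + 4) * (X.l - 3) * FinDivisor.ndeg F X.qDivisor := mul_le_mul_of_nonneg_left h hpos

/-- The threshold itself: `(⋆) ⟺ deĝ̲(𝔮) ≤ c(l)·log π`, `c(l) = 6l(l+5)/((l+4)(l−3))`. [cite: DupuyHilado2025, §3.3]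
[claim: Mochizuki2012, status: disputed] -/
theorem archCornerIneq_iff_ndeg_qDivisor_le :
    -FinDivisor.ndeg F X.qPilot ≤ -LgpDivisor.ndegLgp X.thetaPilot +
        processionNormalized (fun i : Fin (thetaIndex X).lstar =>
          (Fintype.card ((thetaIndex X).Caps (Cor312.Setting.labelSucc i)) : ℝ) * Real.log Real.pi) ↔
      FinDivisor.ndeg F X.qDivisor ≤ 6 * X.l * (X.l + 5) / ((X.l + 4) * (X.l - 3)) * Real.log Real.pi := by
  rw [archCornerIneq_iff_qDivisor]
  have h5 : (5 : ℝ) ≤ X.l := by exact_mod_cast X.five_le_l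
  have hpos : (0 : ℝ) < ((X.l : ℝ) + 4) * (X.l - 3) := by nlinarith
  rw [div_mul_eq_mul_div, le_div_iff₀ hpos]
  constructor <;> intro h <;> linarith

/-- The threshold constant is squeezed uniformly: `6 < c(l) ≤ 50/3` for every prime `l ≥ 5` (it decreases to `6`). [folklore] -/
theorem six_lt_archCornerConst_le (l : ℝ) (hl : 5 ≤ l) :
    6 < 6 * l * (l + 5) / ((l + 4) * (l - 3)) ∧ 6 * l * (l + 5) / ((l + 4) * (l - 3)) ≤ 50 / 3 := by
  have hpos : (0 : ℝ) < (l + 4) * (l - 3) := by nlinarith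
  constructor
  · rw [lt_div_iff₀ hpos]; nlinarith
  · rw [div_le_iff₀ hpos]; nlinarith

end Summit.ABC.IUTFork.Thm311.Real

/-! ## 4. At GENUINE initial Θ-data: `(⋆)` in terms of `log(q)` of [IUTchIV] Theorem 1.10 -/

namespace Summit.ABC.IUTFork.Cor312Prov

open Literature.IUT.HodgeTheaters Literature.IUT.LogVolume Literature.IUT.LogThetaLattice NumberField
  IsDedekindDomain Thm311 Thm311.Real

universe u v w

variable {F : Type} {K : Type v} {Fbar : Type w} [Field F] [NumberField F] [Field K] [NumberField K]
  [Algebra F K] [Field Fbar] [Algebra F Fbar] [Algebra K Fbar] {E : WeierstrassCurve F} [E.IsElliptic]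
  {l : ℕ} {Pb : BadPlacePredicates K} {D : InitialThetaData F K Fbar E l Pb} {X : PilotData F}

/-- **`(⋆)` at the pilot datum OF a collection of initial Θ-data** (`IsPilotDataOf D X`: same `l`, `S = 𝕍(F)^bad`,
`ord_v(q_v)` the Tate-parameter orders, so `deĝ̲(𝔮) = log(q)` by abc-iut-c312-8's `logq_eq_ndeg_qDivisor`):
`(⋆) ⟺ (l+4)(l−3)·log(q) ≤ 6l(l+5)·log π`. [cite: Mochizuki2012, IUTchIV Thm 1.10 p. 22–23]
[claim: Mochizuki2012, status: disputed] -/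
theorem archCornerIneq_iff_logq (h : IsPilotDataOf D X) :
    -FinDivisor.ndeg F X.qPilot ≤ -LgpDivisor.ndegLgp X.thetaPilot +
        processionNormalized (fun i : Fin (thetaIndex X).lstar =>
          (Fintype.card ((thetaIndex X).Caps (Cor312.Setting.labelSucc i)) : ℝ) * Real.log Real.pi) ↔
      ((l : ℝ) + 4) * (l - 3) * logq D ≤ 6 * l * (l + 5) * Real.log Real.pi := by
  rw [archCornerIneq_iff_qDivisor, ← logq_eq_ndeg_qDivisor h, h.l_eq]

/-- At genuine Θ-data with `log(q) ≤ 6`, `(⋆)` holds (every prime `l ≥ 5` of the datum). [cite: Mochizuki2012, IUTchIV Thm 1.10 p. 22–23]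
[claim: Mochizuki2012, status: disputed] -/
theorem archCornerIneq_of_logq_le_six (h : IsPilotDataOf D X) (hq : logq D ≤ 6) :
    -FinDivisor.ndeg F X.qPilot ≤ -LgpDivisor.ndegLgp X.thetaPilot +
        processionNormalized (fun i : Fin (thetaIndex X).lstar =>
          (Fintype.card ((thetaIndex X).Caps (Cor312.Setting.labelSucc i)) : ℝ) * Real.log Real.pi) :=
  archCornerIneq_of_ndeg_qDivisor_le_six X (by rwa [← logq_eq_ndeg_qDivisor h])

/-- At genuine Θ-data with `log(q) ≥ 20`, `(⋆)` fails (every prime `l ≥ 5` of the datum): TEAM B's region-volume input is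
FALSE at the honest-`∞` corner for all such data. [cite: Mochizuki2012, IUTchIV Thm 1.10 p. 22–23]
[claim: Mochizuki2012, status: disputed] -/
theorem not_archCornerIneq_of_twenty_le_logq (h : IsPilotDataOf D X) (hq : 20 ≤ logq D) :
    ¬ (-FinDivisor.ndeg F X.qPilot ≤ -LgpDivisor.ndegLgp X.thetaPilot +
        processionNormalized (fun i : Fin (thetaIndex X).lstar =>
          (Fintype.card ((thetaIndex X).Caps (Cor312.Setting.labelSucc i)) : ℝ) * Real.log Real.pi)) :=
  not_archCornerIneq_of_twenty_le_ndeg_qDivisor X (by rwa [← logq_eq_ndeg_qDivisor h])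

end Summit.ABC.IUTFork.Cor312Prov

end
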